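import Summits.CriticalPhenomena.PercolationContinuityZ3.Theorems.PercNearOneGluingNoHeavyLowerTailKnQuestion8CoefficientwiseCoreClassKernelMixTwoStageFull

/-!
# From the Hall-form count to injective witnesses (generic), for the chordless FULL-induction

Support file (`--supports stmt-CriticalPhenomena-4575`, closed), prover `prim-cplus-coupling` (gen 73).  No definitions, no notations, no named facts,
no sorries; standard axioms.  Memo `prim-cplus-coupling/A5-COUPLING-gen73.md` §3.

`TwoStageFull.two_stage_full_count` (THEOREM RF, abstract form) concludes with the HALL FORM of the FULL property: for every upper set `W`, the
coincident pairs whose common upper cone lies in `W` number at most `#(W ∩ G)`.  This file converts any such count, for an arbitrary finite set of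
pairs `Coll` and region `G`, into an injective witness map `ω : Coll → G` with `ω c` above both components (`exists_witnesses_of_count`) — Hall's
marriage theorem with neighbourhoods `↑c.1 ∩ ↑c.2 ∩ G`, exactly as in `Bouquet.exists_witness_injection` for THEOREM A.  Together with
`FullMatching.jp_of_full` this closes the abstract pipeline RF-count ⟹ FULL witnesses ⟹ JP.
[cite: KozmaNitzan2024, Questions 8–9 (§5.5 p. 36) (context); Harris 1960; Kleitman 1966]
-/

namespace Summit.CriticalPhenomena.PercolationContinuityZ3.Theorems.Coefficientwise.HallWitness

open Finset

variable {X : Type*} [Fintype X] [DecidableEq X] [Preorder X]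

open Classical in
/-- **Witnesses from the Hall-form count.**  If for every upper set `W` the pairs of `Coll` whose common upper cone lies in `W` number at most
`#(W ∩ G)`, then there is a map `ω`, injective on `Coll`, with `ω c ∈ G`, `c.1 ≤ ω c` and `c.2 ≤ ω c` for every `c ∈ Coll`. -/
theorem exists_witnesses_of_count (Coll : Finset (X × X)) (G : Finset X)
    (hcount : ∀ W : Finset X, IsUpperSet (W : Set X) →
      (Coll.filter (fun c => ∀ q : X, c.1 ≤ q → c.2 ≤ q → q ∈ W)).card ≤ (W ∩ G).card) :
    ∃ ω : X × X → X, Set.InjOn ω (Coll : Set (X × X)) ∧ ∀ c ∈ Coll, ω c ∈ G ∧ c.1 ≤ ω c ∧ c.2 ≤ ω c := by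
  -- admissible witnesses of a pair
  let N : Coll → Finset X := fun c => G.filter (fun g => (c : X × X).1 ≤ g ∧ (c : X × X).2 ≤ g)
  have hHall : ∀ s : Finset Coll, s.card ≤ (s.biUnion N).card := by
    intro s
    set s' : Finset (X × X) := s.image (fun c : Coll => (c : X × X)) with hs'
    have hcard : s.card = s'.card := by rw [hs', card_image_of_injective _ Subtype.val_injective]
    have hs'C : s' ⊆ Coll := by
      intro c hc
      obtain ⟨c', _, rfl⟩ := mem_image.mp hc
      exact c'.2
    -- the union of the common upper cones of the pairs of s'
    set U : Finset X := univ.filter (fun q => ∃ c ∈ s', c.1 ≤ q ∧ c.2 ≤ q) with hU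
    have hmemU : ∀ {q}, q ∈ U ↔ ∃ c ∈ s', c.1 ≤ q ∧ c.2 ≤ q := by intro q; simp [hU]
    have hUup : IsUpperSet (U : Set X) := by
      intro a b hab ha
      obtain ⟨c, hc, h1, h2⟩ := hmemU.mp (mem_coe.mp ha)
      exact mem_coe.mpr (hmemU.mpr ⟨c, hc, le_trans h1 hab, le_trans h2 hab⟩)
    have hsub1 : s' ⊆ Coll.filter (fun c => ∀ q : X, c.1 ≤ q → c.2 ≤ q → q ∈ U) := by
      intro c hc
      exact mem_filter.mpr ⟨hs'C hc, fun q h1 h2 => hmemU.mpr ⟨c, hc, h1, h2⟩⟩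
    have hsub2 : U ∩ G ⊆ s.biUnion N := by
      intro q hq
      obtain ⟨hqU, hqG⟩ := mem_inter.mp hq
      obtain ⟨c, hc, h1, h2⟩ := hmemU.mp hqU
      obtain ⟨c', hc's, hcc'⟩ := mem_image.mp hc
      refine mem_biUnion.mpr ⟨c', hc's, mem_filter.mpr ⟨hqG, ?_, ?_⟩⟩
      · rw [hcc']; exact h1
      · rw [hcc']; exact h2
    calc s.card = s'.card := hcard
      _ ≤ (Coll.filter (fun c => ∀ q : X, c.1 ≤ q → c.2 ≤ q → q ∈ U)).card := card_le_card hsub1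
      _ ≤ (U ∩ G).card := hcount U hUup
      _ ≤ (s.biUnion N).card := card_le_card hsub2
  obtain ⟨f, hfinj, hfN⟩ := (all_card_le_biUnion_card_iff_exists_injective N).1 hHall
  refine ⟨fun c => if h : c ∈ Coll then f ⟨c, h⟩ else c.1, ?_, ?_⟩
  · intro a ha b hb hab
    have ha' : a ∈ Coll := mem_coe.mp ha
    have hb' : b ∈ Coll := mem_coe.mp hb
    simp only [ha', hb', dif_pos] at hab
    exact congrArg Subtype.val (hfinj hab)
  · intro c hc
    have hmem := hfN ⟨c, hc⟩
    obtain ⟨hG, h1, h2⟩ := mem_filter.mp hmem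
    simp only [hc, dif_pos]
    exact ⟨hG, h1, h2⟩

end Summit.CriticalPhenomena.PercolationContinuityZ3.Theorems.Coefficientwise.HallWitness
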